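import Literature.MathematicalPhysics.QuantumFieldTheory.Balaban1983to89.HiggsDoubleRT
import Literature.MathematicalPhysics.QuantumFieldTheory.Balaban1983to89.B2Eq21FirstStep

/-!
# `Balaban1983to89.HiggsDoubleRTRescale` — T. Bałaban, *(Higgs)₂,₃ quantum fields in a finite volume. I. A lower bound*,
Commun. Math. Phys. **85** (1982) 603–626 [Balaban1982Higgs1], p. 607 (1.22)–(1.23), p. 613 (3.6)→(3.7), p. 618
(3.37)→(3.38): the CANONICAL RESCALING of the double renormalization transformation at every level `k` — *"The first
step in the calculation is a rescaling of all the fields and the propagators from L^kε-lattice T^{(k)}_{L^kε} to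
1-lattice T^{(k)}_1. After the rescaling the integral transforms into the integral const χ_{k+1}(B)χ_{k+1}(ψ)∫dA∫dφ …"*
(p. 618–619) — for an ARBITRARY density: the double transformation `HiggsDoubleRT.doubleRTk` on the `ε`-family of
lattices, evaluated at rescaled block fields, IS a constant times the double transformation on the `sε`-family of the
pulled-back density, with the rescaled charge `e_s` (p. 607), PROVED by the change of variables (1.22)

statement-level skeleton of published theorems with citation tags; proofs where landed; nothing here is a claim about the Yang–Mills mass gap

PDF held: `paper:balaban1982-cmp85-higgs23-i` (journal page = PDF page + 602).  pp. 607, 613, 618–619 read from the ×2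
renders `run/shared/lean/pub/pub-balaban/b2b-balaban-ref1/pages/1982-cmp85-higgs23-I/…-p005-x2.png`, `…-p011-x2.png`,
`…-p016-x2.png`, `…-p017-x2.png`, never from the OCR layer.

CITATION HEADER (lean-in-tree rule).  lit-balaban typed skeleton (HOME `run/shared/lean/pub/lit-balaban/`), typer line
(carrier API; rows of record unchanged): rows **B1.Eq1.22** (r01/r14, `HiggsRescaling`), **B1.Eq3.7** (r12
`B1Sect3Statements.action37`; concrete `B2Eq21FirstStep.doubleRT_rescale` = the case `k = 0`, density `χe^{−S^ε}`),
**B1.Eq3.37-3.38** (r12; the (3.38) member = this rescaling applied to the (3.37) integral, whose integrand — the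
effective action (3.30) — is not constructed in the tree: HERE the density is a parameter).  WHAT IS REPRODUCED.  p. 607
[PDF 5], verbatim (text layer `p0005.txt` ll. 21–35): *"An important role is played in the paper by the operations of
rescaling done on the fields and operators. Let us consider the rescalings of the fields, because they determine the
others. We use only the canonical rescalings, so we have [(1.22)] and the same formulas for vector fields. They imply the
formulas for the rescalings of the functions of fields, e.g. we have for a derivative [(1.23)] … If we rescale (1.11) from
the ε-lattice to an sε-lattice, then from (1.22), (1.23) it follows that we get the action again of the form (1.11), but
with ε replaced by sε, T_ε by T_{sε}, the constants m₀², μ₀² are replaced by m₀²s⁻², μ₀²s⁻², and the coupling constants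
e, λ are replaced by λ_s = λs^{−(4−d)}, e_s = es^{−(4−d)/2}."* (v1.1 ERRATUM, docstrings only: v1 of this header opened the
quotation with *"we will use only one canonical way connected with the scaling properties of the expression (1.11)"*, which
is NOT the printed wording — the print says *"We use only the canonical rescalings"* —; found by the typer's g19 quotation
audit `HOME/lit-balaban-typer/QUOTE-AUDIT.md`; no declaration is touched); p. 618–619 [PDF 16–17]: *"The first step in the calculation is a rescaling
of all the fields and the propagators from L^kε-lattice T^{(k)}_{L^kε} to 1-lattice T^{(k)}_1. After the rescaling the
integral transforms into the integral const χ_{k+1}(B)χ_{k+1}(ψ)∫dA∫dφ χ_k(A)χ_k(φ)exp[−½aL^{d−2}Σ_{y∈T_L^{(k+1)}}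
|B(y)−(QA)(y)|² − ½aL^{d−2}Σ_{y∈T_L^{(k+1)}}|ψ(y)−(Q(A^{(k)})φ)(y)|² − …] (3.38)"*.  DICTIONARY: the `ε`-family `P`
and the `sε`-family `P.scaleBy s hs` (`HiggsRescaling`; in print `s = (L^kε)^{−1}` so that the level-`k` lattice has
spacing `1` and the level-`(k+1)` lattice spacing `L`); the rescalings (1.22) `HiggsRescaling.rescaleScalar/rescaleVec`
(`φ = σφ′`, `A = σA′`, `σ = s^{(d−2)/2}`, same labels); the charge `e_s` = `ChargeData.scaleBy`; the double
transformation `HiggsDoubleRT.doubleRTk C a ext ρ` at an external-field assignment `ext` (↤ `A ↦ A` in (3.6),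
`A ↦ A^{(k),ε}` in (3.37)) which is assumed to be COVARIANT under the rescaling (`ext (σA′) = σ·ext′(A′)`, hypothesis
`hext`; for `A ↦ A` trivially, for `A ↦ A^{(k),ε}` it is the rescaling of the propagators of (3.29), not treated here).
PROVED, in this order: (§1) `a(L^{k+1}ε)^{d−2}σ² = a(L^{k+1}sε)^{d−2}` (the Gaussian precision absorbs the field factor:
the terms `|ψ − Q(A)φ|²` carry no lattice weight, cf. `aL^{d−2}` in (3.38)) and the one-site identity
`t_{κσ²}(v) = σ^N t_κ(σv)`; (§2) the two one-step kernels under the rescaling: `t^{sε}(ψ′, φ′) = σ^{N|T^{(k+1)}|}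
t^{ε}(σψ′, σφ′)` at the rescaled charge (scalar fields, through `B2Eq21FirstStep.avgQ_rescale`) and `= σ^{d|T^{(k+1)}|}·(…)`
for the vector-field kernel (`Q` commutes with `σ·`); (§3) **`doubleRTk_rescale`**: `T^{ε}T^{ε}[ρ](σB′, σψ′) =
rescaleFactor · T^{sε}T^{sε}[ρ(σ·, σ·)](B′, ψ′)` with the explicit constant `rescaleFactor = σ^{|bonds of T^{(k)}| +
N|T^{(k)}|}/σ^{(d+N)|T^{(k+1)}|}` (the Jacobians of `dA dφ`, `B2Eq21FirstStep.integral_comp_rescaleVec/…Scalar`, over the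
kernel prefactors); (§4) the OUTER integral: `∫dB∫dψ χ′(B,ψ)·T T[ρ](B,ψ) = const · ∫dB′∫dψ′ χ′(σB′,σψ′)·T^{sε}T^{sε}[ρ(σ·,σ·)]
(B′,ψ′)` (`integral_cutoff_doubleRTk_rescale`, via `HiggsRescaling.integral_comp_rescale`) — the sentence *"the integral
transforms into the integral const …"* of (3.38) for a general density and weight.  No integrability is used (Bochner
integrals on both sides).
DELIBERATELY NOT HERE: the covariance of `A ↦ A^{(k),ε}` (rescaling of the propagators `G_k` in (3.29)); the explicit
integrand of (3.38) (effective action (3.30)–(3.36), rows B1.Eq3.30–3.36); the choice `s = (L^kε)^{−1}`.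
Unit `lit-balaban-typer` gen 3 (literature-prover-lit-balaban-typer-g3-0); v1.1 (gen 19, literature-prover-lit-balaban-typer-g19-0)
= DOCSTRING-ONLY erratum of the p. 607 quotation in this header, every declaration byte-identical; HOME/FILED.md records the proposals.
-/

open scoped BigOperators
open _root_.MeasureTheory _root_.Real

namespace Literature.MathematicalPhysics.QuantumFieldTheory.Balaban1983to89.HiggsDoubleRTRescale

open Literature.MathematicalPhysics.QuantumFieldTheory.Balaban1983to89.HiggsLattice
open Literature.MathematicalPhysics.QuantumFieldTheory.Balaban1983to89.HiggsAveraging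
open Literature.MathematicalPhysics.QuantumFieldTheory.Balaban1983to89.B1RT
open Literature.MathematicalPhysics.QuantumFieldTheory.Balaban1983to89.HiggsRescaling
open Literature.MathematicalPhysics.QuantumFieldTheory.Balaban1983to89.HiggsDoubleRT
open Literature.MathematicalPhysics.QuantumFieldTheory.Balaban1983to89.B2Eq21FirstStep
  (toSite_rescaleVec avgQ_rescale integral_comp_rescaleVec integral_comp_rescaleScalar)
open Literature.MathematicalPhysics.QuantumFieldTheory.Balaban1983to89.B3MultiscaleFields (toSite zeroCharge)

variable {P : Params} {k N : ℕ} {s : ℝ}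

/-! ## 1. Scale bookkeeping: the precision absorbs the field factor; the one-site Gaussian under `v ↦ σv` -/

section Bookkeeping

/-- The field factor `σ = s^{(d−2)/2}` of (1.22) is positive. [cite: Balaban1982Higgs1, (1.22) p.607] -/
theorem sigma_pos (P : Params) (hs : 0 < s) : 0 < s ^ (((P.d : ℝ) - 2) / 2) :=
  Real.rpow_pos_of_pos hs _

/-- **The Gaussian precision of the one-step kernels absorbs the field factor of (1.22)** at every level:
`a(L^{k+1}ε)^{d−2}·σ² = a(L^{k+1}sε)^{d−2}` — the terms `|ψ(y) − (Q(A)φ)(y)|²` of (2.6) carry no weight `η^d`, which is why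
(3.38) shows `aL^{d−2}` on the unit lattice (`B2Eq21FirstStep.prec_mul_sq_rescale` is the case `k = 0`).
[cite: Balaban1982Higgs1, (3.38) p.619] -/
theorem prec_rescale (hs : 0 < s) (a : ℝ) (k : ℕ) :
    prec a (P.mesh (k + 1)) P.d * (s ^ (((P.d : ℝ) - 2) / 2)) ^ 2
      = prec a ((P.scaleBy s hs).mesh (k + 1)) (P.scaleBy s hs).d := by
  have hσ : (s ^ (((P.d : ℝ) - 2) / 2)) ^ 2 = s ^ ((P.d : ℤ) - 2) := by
    rw [← Real.rpow_natCast _ 2, ← Real.rpow_mul hs.le, ← Real.rpow_intCast]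
    congr 1
    push_cast
    ring
  rw [hσ, scaleBy_d, mesh_scaleBy, prec_eq, prec_eq, mul_zpow]
  ring

/-- The precision `a(L^{k+1}ε)^{d−2}` is non-negative for `a ≥ 0`. [cite: Balaban1982Higgs1, (2.6) p.608] -/
theorem prec_step_nonneg {a : ℝ} (ha : 0 ≤ a) (k : ℕ) : 0 ≤ prec a (P.mesh (k + 1)) P.d := by
  rw [prec_eq]
  exact mul_nonneg ha (zpow_nonneg (P.mesh_pos (k + 1)).le _)

variable {V : Type*} [NormedAddCommGroup V] [InnerProductSpace ℝ V]

/-- **The one-site Gaussian (2.6) under the homothety `v ↦ σv`**: `t_{κσ²}(v) = σ^N · t_κ(σv)` (`N = dim V`; the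
exponent is invariant, the prefactor `(κ/2π)^{N/2}` picks up `σ^N` — the Jacobian of `σ·` on one site).
[cite: Balaban1982Higgs1, (2.6) p.608] -/
theorem rtKernel_smul {κ σ : ℝ} (hκ : 0 ≤ κ) (hσ : 0 < σ) (v : V) :
    rtKernel (κ * σ ^ 2) v = σ ^ Module.finrank ℝ V * rtKernel κ (σ • v) := by
  rw [rtKernel_eq, rtKernel_eq, norm_smul, Real.norm_of_nonneg hσ.le, mul_pow]
  have h2 : (σ ^ 2) ^ ((Module.finrank ℝ V : ℝ) / 2) = σ ^ Module.finrank ℝ V := by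
    rw [← Real.rpow_natCast σ 2, ← Real.rpow_mul hσ.le, ← Real.rpow_natCast σ (Module.finrank ℝ V)]
    congr 1
    push_cast
    ring
  have h1 : (κ * σ ^ 2 / (2 * π)) ^ ((Module.finrank ℝ V : ℝ) / 2)
      = σ ^ Module.finrank ℝ V * (κ / (2 * π)) ^ ((Module.finrank ℝ V : ℝ) / 2) := by
    rw [show κ * σ ^ 2 / (2 * π) = σ ^ 2 * (κ / (2 * π)) by ring,
      Real.mul_rpow (pow_nonneg hσ.le 2) (div_nonneg hκ (by positivity)), h2]
  have h3 : -(κ * σ ^ 2 / 2) * ‖v‖ ^ 2 = -(κ / 2) * (σ ^ 2 * ‖v‖ ^ 2) := by ring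
  rw [h1, h3]
  ring

/-- The block form: `Π_y t_{κσ²}(ψ(y) − g(y)) = (σ^N)^{|Y|} Π_y t_κ(σψ(y) − σg(y))`. [cite: Balaban1982Higgs1, (2.5) p.608] -/
theorem prod_rtKernel_smul {Y : Type*} [Fintype Y] {κ σ : ℝ} (hκ : 0 ≤ κ) (hσ : 0 < σ) (ψ g : Y → V) :
    ∏ y, rtKernel (κ * σ ^ 2) (ψ y - g y)
      = (σ ^ Module.finrank ℝ V) ^ Fintype.card Y * ∏ y, rtKernel κ (σ • ψ y - σ • g y) := by
  rw [← Finset.card_univ, ← Finset.prod_const, ← Finset.prod_mul_distrib]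
  refine Finset.prod_congr rfl fun y _ => ?_
  rw [← smul_sub, rtKernel_smul hκ hσ]

end Bookkeeping

/-! ## 2. The two one-step kernels at level `k` under the rescaling (1.22) -/

section Kernels

/-- `Q(0)` (the plain block average, `HiggsDoubleRT.avgQ_zero_apply`) commutes with the rescaling (1.22): it is linear
and the blocks are the same labels on the two families; the charge data are immaterial at the zero field.
[cite: Balaban1982Higgs1, (2.7) p.608] -/
theorem avgQ_zero_rescale (hs : 0 < s) (C C' : ChargeData N) (f' : ScalarField (P.scaleBy s hs) k N) :
    avgQ C (0 : VecField P 0) (rescaleScalar hs f')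
      = rescaleScalar hs (avgQ (P := P.scaleBy s hs) C' (0 : VecField (P.scaleBy s hs) 0) f') := by
  funext y
  rw [avgQ_zero_apply]
  simp only [rescaleScalar]
  rw [avgQ_zero_apply, ← Finset.smul_sum, smul_comm]
  rfl

/-- **The scalar-field kernel (2.5)–(2.6) under the rescaling** (external field on the finest lattice, fields of levels
`k+1`, `k`): `t^{sε}_{a,L,A′}(ψ′, φ′)` at the rescaled charge `e_s` equals `σ^{N|T^{(k+1)}|} · t^{ε}_{a,L,σA′}(σψ′, σφ′)` —
`Q(σA′)(σφ′) = σ·Q_{e_s}(A′)φ′` (`B2Eq21FirstStep.avgQ_rescale`), the precision absorbs `σ²` (`prec_rescale`) and each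
site prefactor yields `σ^N`. PROVED. [cite: Balaban1982Higgs1, (2.6) p.608] -/
theorem rtKernelStep_rescale (hs : 0 < s) (C : ChargeData N) {a : ℝ} (ha : 0 ≤ a)
    (A₀' : VecField (P.scaleBy s hs) 0) (ψ' : ScalarField (P.scaleBy s hs) (k + 1) N)
    (φ' : ScalarField (P.scaleBy s hs) k N) :
    rtKernelStep (P := P.scaleBy s hs) (k := k) (C.scaleBy P.d s) a A₀' ψ' φ'
      = (s ^ (((P.d : ℝ) - 2) / 2)) ^ (N * Fintype.card (Site P (k + 1)))
          * rtKernelStep (k := k) C a (rescaleVec hs A₀') (rescaleScalar hs ψ') (rescaleScalar hs φ') := by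
  unfold rtKernelStep
  rw [blockKernel_eq, blockKernel_eq, avgQ_rescale hs C A₀' φ', ← prec_rescale hs a k,
    prod_rtKernel_smul (prec_step_nonneg (P := P) ha k) (sigma_pos P hs), finrank_euclideanSpace_fin, ← pow_mul]
  rfl

/-- **The vector-field kernel under the rescaling** (*"the same formulas for vector fields"*, p. 607):
`t^{sε}_{a,L}(B′, A′) = σ^{d|T^{(k+1)}|} · t^{ε}_{a,L}(σB′, σA′)` (`Q` commutes with `σ·`, `avgQ_zero_rescale`; `N = d`).
PROVED. [cite: Balaban1982Higgs1, (1.22) p.607] -/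
theorem vecKernel_rescale (hs : 0 < s) {a : ℝ} (ha : 0 ≤ a) (B' : VecField (P.scaleBy s hs) (k + 1))
    (A' : VecField (P.scaleBy s hs) k) :
    vecKernel (P := P.scaleBy s hs) a B' A'
      = (s ^ (((P.d : ℝ) - 2) / 2)) ^ (P.d * Fintype.card (Site P (k + 1)))
          * vecKernel a (rescaleVec hs B') (rescaleVec hs A') := by
  rw [vecKernel_eq, vecKernel_eq, toSite_rescaleVec hs B', toSite_rescaleVec hs A', blockKernel_eq, blockKernel_eq,
    avgQ_zero_rescale hs (zeroCharge P.d) (zeroCharge P.d) (toSite (P := P.scaleBy s hs) A'),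
    ← prec_rescale hs a k, prod_rtKernel_smul (prec_step_nonneg (P := P) ha k) (sigma_pos P hs),
    finrank_euclideanSpace_fin, ← pow_mul]
  rfl

end Kernels

/-! ## 3. The double transformation under the rescaling -/

section Double

/-- The constant of the rescaling of the double transformation at level `k` (the *"const"* of (3.7) p. 613 / (3.38)
p. 619 before the outer change of variables): the Jacobian `σ^{|bonds of T^{(k)}| + N|T^{(k)}|}` of `dA dφ` over the
kernel prefactors `σ^{(d+N)|T^{(k+1)}|}`, `σ = s^{(d−2)/2}`. [cite: Balaban1982Higgs1, (3.38) p.619] -/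
noncomputable def rescaleFactor (P : Params) (N k : ℕ) (s : ℝ) : ℝ :=
  (s ^ (((P.d : ℝ) - 2) / 2)) ^ (Fintype.card (PBond P k) + N * Fintype.card (Site P k))
    / (s ^ (((P.d : ℝ) - 2) / 2)) ^ ((P.d + N) * Fintype.card (Site P (k + 1)))

/-- The rescaling constant is positive. [cite: Balaban1982Higgs1, (3.38) p.619] -/
theorem rescaleFactor_pos (P : Params) (N k : ℕ) (hs : 0 < s) : 0 < rescaleFactor P N k s :=
  div_pos (pow_pos (sigma_pos P hs) _) (pow_pos (sigma_pos P hs) _)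

/-- The double transformation on the `sε`-family of the pulled-back density, in terms of the one on the `ε`-family at
the rescaled block fields (inverse form of `doubleRTk_rescale`; the change of variables (1.22) in `dA′ dφ′`).
[cite: Balaban1982Higgs1, (3.38) p.619] -/
theorem doubleRTk_rescale_inv (hs : 0 < s) (C : ChargeData N) {a : ℝ} (ha : 0 ≤ a)
    {ext : VecField P k → VecField P 0} {ext' : VecField (P.scaleBy s hs) k → VecField (P.scaleBy s hs) 0}
    (hext : ∀ A', ext (rescaleVec hs A') = rescaleVec hs (ext' A')) (ρ : VecField P k → ScalarField P k N → ℝ)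
    (B' : VecField (P.scaleBy s hs) (k + 1)) (ψ' : ScalarField (P.scaleBy s hs) (k + 1) N) :
    doubleRTk (P := P.scaleBy s hs) (C.scaleBy P.d s) a ext'
        (fun A' φ' => ρ (rescaleVec hs A') (rescaleScalar hs φ')) B' ψ'
      = (s ^ (((P.d : ℝ) - 2) / 2)) ^ (P.d * Fintype.card (Site P (k + 1)))
          * (s ^ (((P.d : ℝ) - 2) / 2)) ^ (N * Fintype.card (Site P (k + 1)))
          * (|((s ^ (((P.d : ℝ) - 2) / 2)) ^ Fintype.card (PBond P k))⁻¹|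
            * |((s ^ (((P.d : ℝ) - 2) / 2)) ^ (N * Fintype.card (Site P k)))⁻¹|)
          * doubleRTk C a ext ρ (rescaleVec hs B') (rescaleScalar hs ψ') := by
  set σ := s ^ (((P.d : ℝ) - 2) / 2) with hσdef
  rw [doubleRTk_eq, doubleRTk_eq]
  have hV : ∀ A' : VecField (P.scaleBy s hs) k, vecKernel (P := P.scaleBy s hs) a B' A'
      = σ ^ (P.d * Fintype.card (Site P (k + 1))) * vecKernel a (rescaleVec hs B') (rescaleVec hs A') :=
    fun A' => vecKernel_rescale hs ha B' A'
  have hS : ∀ (A' : VecField (P.scaleBy s hs) k) (φ' : ScalarField (P.scaleBy s hs) k N),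
      rtKernelStep (P := P.scaleBy s hs) (k := k) (C.scaleBy P.d s) a (ext' A') ψ' φ'
        = σ ^ (N * Fintype.card (Site P (k + 1)))
            * rtKernelStep (k := k) C a (ext (rescaleVec hs A')) (rescaleScalar hs ψ') (rescaleScalar hs φ') := by
    intro A' φ'
    rw [rtKernelStep_rescale hs C ha (ext' A') ψ' φ', ← hext A']
  simp_rw [hV, hS]
  have hin : ∀ A' : VecField (P.scaleBy s hs) k,
      (∫ φ' : ScalarField (P.scaleBy s hs) k N,
          σ ^ (N * Fintype.card (Site P (k + 1)))
            * rtKernelStep (k := k) C a (ext (rescaleVec hs A')) (rescaleScalar hs ψ') (rescaleScalar hs φ')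
            * ρ (rescaleVec hs A') (rescaleScalar hs φ'))
        = σ ^ (N * Fintype.card (Site P (k + 1)))
            * (|(σ ^ (N * Fintype.card (Site P k)))⁻¹|
              * ∫ φ : ScalarField P k N,
                  rtKernelStep (k := k) C a (ext (rescaleVec hs A')) (rescaleScalar hs ψ') φ * ρ (rescaleVec hs A') φ) := by
    intro A'
    rw [← integral_comp_rescaleScalar hs (fun φ : ScalarField P k N =>
        rtKernelStep (k := k) C a (ext (rescaleVec hs A')) (rescaleScalar hs ψ') φ * ρ (rescaleVec hs A') φ),
      ← integral_const_mul]
    refine integral_congr_ae (Filter.Eventually.of_forall fun φ' => ?_)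
    simp only
    ring
  simp_rw [hin]
  have hout : (∫ A' : VecField (P.scaleBy s hs) k,
        σ ^ (P.d * Fintype.card (Site P (k + 1))) * vecKernel a (rescaleVec hs B') (rescaleVec hs A')
          * (σ ^ (N * Fintype.card (Site P (k + 1)))
            * (|(σ ^ (N * Fintype.card (Site P k)))⁻¹|
              * ∫ φ : ScalarField P k N,
                  rtKernelStep (k := k) C a (ext (rescaleVec hs A')) (rescaleScalar hs ψ') φ * ρ (rescaleVec hs A') φ)))
      = σ ^ (P.d * Fintype.card (Site P (k + 1))) * σ ^ (N * Fintype.card (Site P (k + 1)))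
          * |(σ ^ (N * Fintype.card (Site P k)))⁻¹|
          * ∫ A' : VecField (P.scaleBy s hs) k,
              (fun A : VecField P k => vecKernel a (rescaleVec hs B') A
                * ∫ φ : ScalarField P k N, rtKernelStep (k := k) C a (ext A) (rescaleScalar hs ψ') φ * ρ A φ)
                (rescaleVec hs A') := by
    rw [← integral_const_mul]
    refine integral_congr_ae (Filter.Eventually.of_forall fun A' => ?_)
    simp only
    ring
  have hcv := integral_comp_rescaleVec (P := P) (k := k) hs
    (fun A : VecField P k => vecKernel a (rescaleVec hs B') A
      * ∫ φ : ScalarField P k N, rtKernelStep (k := k) C a (ext A) (rescaleScalar hs ψ') φ * ρ A φ)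
  rw [hout, hcv]
  ring

/-- **The double renormalization transformation under the canonical rescaling (1.22)** — p. 618–619, *"a rescaling of
all the fields … from L^kε-lattice to 1-lattice"*, for an ARBITRARY density `ρ` and any rescaling-covariant external-field
assignment: for `s > 0`, `a ≥ 0`, block fields `B′, ψ′` of the `sε`-family,
`T^{ε}_{a,L}[T^{ε}_{a,L,Ã}[ρ]](σB′, σψ′) = rescaleFactor · T^{sε}_{a,L}[T^{sε}_{a,L,Ã′}[ρ(σ·, σ·)]](B′, ψ′)`
at the rescaled charge `e_s` (`ChargeData.scaleBy`), `σ = s^{(d−2)/2}`. PROVED (change of variables in `dA dφ` +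
the kernel identities of §2; no integrability needed). [cite: Balaban1982Higgs1, (3.38) p.619] -/
theorem doubleRTk_rescale (hs : 0 < s) (C : ChargeData N) {a : ℝ} (ha : 0 ≤ a)
    {ext : VecField P k → VecField P 0} {ext' : VecField (P.scaleBy s hs) k → VecField (P.scaleBy s hs) 0}
    (hext : ∀ A', ext (rescaleVec hs A') = rescaleVec hs (ext' A')) (ρ : VecField P k → ScalarField P k N → ℝ)
    (B' : VecField (P.scaleBy s hs) (k + 1)) (ψ' : ScalarField (P.scaleBy s hs) (k + 1) N) :
    doubleRTk C a ext ρ (rescaleVec hs B') (rescaleScalar hs ψ')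
      = rescaleFactor P N k s
          * doubleRTk (P := P.scaleBy s hs) (C.scaleBy P.d s) a ext'
              (fun A' φ' => ρ (rescaleVec hs A') (rescaleScalar hs φ')) B' ψ' := by
  have hσ := sigma_pos P hs
  rw [doubleRTk_rescale_inv hs C ha hext ρ B' ψ', rescaleFactor,
    abs_of_pos (inv_pos.mpr (pow_pos hσ _)), abs_of_pos (inv_pos.mpr (pow_pos hσ _))]
  have h1 : (s ^ (((P.d : ℝ) - 2) / 2)) ^ Fintype.card (PBond P k) ≠ 0 := (pow_pos hσ _).ne'
  have h2 : (s ^ (((P.d : ℝ) - 2) / 2)) ^ (N * Fintype.card (Site P k)) ≠ 0 := (pow_pos hσ _).ne'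
  have h3 : (s ^ (((P.d : ℝ) - 2) / 2)) ^ ((P.d + N) * Fintype.card (Site P (k + 1))) ≠ 0 := (pow_pos hσ _).ne'
  field_simp
  ring

/-- The case `k = 0`, `Ã(A) = A` of (3.6)→(3.7) p. 613: the identity assignment is trivially covariant (the density
`χe^{−S^ε}` and `s = ε⁻¹` give `B2Eq21FirstStep.doubleRT_rescale`). [cite: Balaban1982Higgs1, (3.7) p.613] -/
theorem doubleRTk_rescale_id (hs : 0 < s) (C : ChargeData N) {a : ℝ} (ha : 0 ≤ a)
    (ρ : VecField P 0 → ScalarField P 0 N → ℝ) (B' : VecField (P.scaleBy s hs) 1)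
    (ψ' : ScalarField (P.scaleBy s hs) 1 N) :
    doubleRTk C a (fun A : VecField P 0 => A) ρ (rescaleVec hs B') (rescaleScalar hs ψ')
      = rescaleFactor P N 0 s
          * doubleRTk (P := P.scaleBy s hs) (C.scaleBy P.d s) a (fun A' : VecField (P.scaleBy s hs) 0 => A')
              (fun A' φ' => ρ (rescaleVec hs A') (rescaleScalar hs φ')) B' ψ' :=
  doubleRTk_rescale hs C ha (ext := fun A : VecField P 0 => A) (ext' := fun A' : VecField (P.scaleBy s hs) 0 => A')
    (fun _ => rfl) ρ B' ψ'

end Double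

/-! ## 4. The outer integral: "the integral transforms into the integral const …" (3.38) -/

section Outer

/-- **(3.37) → (3.38), the change of variables in `dB dψ` as well** (p. 618–619: *"After the rescaling the integral
transforms into the integral const χ_{k+1}(B)χ_{k+1}(ψ)∫dA∫dφ …"*), for an arbitrary density `ρ` and weight `χ′`:
`∫dB∫dψ χ′(B,ψ)·T^{ε}T^{ε}[ρ](B,ψ) = const(s) · ∫dB′∫dψ′ χ′(σB′,σψ′)·T^{sε}T^{sε}[ρ(σ·,σ·)](B′,ψ′)` with
`const(s) = σ^{|bonds of T^{(k+1)}| + N|T^{(k+1)}|} · rescaleFactor`. PROVED (`HiggsRescaling.integral_comp_rescale` +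
`doubleRTk_rescale`). [cite: Balaban1982Higgs1, (3.38) p.619] -/
theorem integral_cutoff_doubleRTk_rescale (hs : 0 < s) (C : ChargeData N) {a : ℝ} (ha : 0 ≤ a)
    {ext : VecField P k → VecField P 0} {ext' : VecField (P.scaleBy s hs) k → VecField (P.scaleBy s hs) 0}
    (hext : ∀ A', ext (rescaleVec hs A') = rescaleVec hs (ext' A')) (ρ : VecField P k → ScalarField P k N → ℝ)
    (χ' : VecField P (k + 1) → ScalarField P (k + 1) N → ℝ) :
    ∫ Ψ : VecField P (k + 1) × ScalarField P (k + 1) N, χ' Ψ.1 Ψ.2 * doubleRTk C a ext ρ Ψ.1 Ψ.2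
      = (s ^ (((P.d : ℝ) - 2) / 2)) ^ (Fintype.card (PBond P (k + 1)) + N * Fintype.card (Site P (k + 1)))
          * rescaleFactor P N k s
          * ∫ Ψ' : VecField (P.scaleBy s hs) (k + 1) × ScalarField (P.scaleBy s hs) (k + 1) N,
              χ' (rescaleVec hs Ψ'.1) (rescaleScalar hs Ψ'.2)
                * doubleRTk (P := P.scaleBy s hs) (C.scaleBy P.d s) a ext'
                    (fun A' φ' => ρ (rescaleVec hs A') (rescaleScalar hs φ')) Ψ'.1 Ψ'.2 := by
  have hσ := sigma_pos P hs
  have h := integral_comp_rescale hs (k := k + 1)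
    (fun Ψ : VecField P (k + 1) × ScalarField P (k + 1) N => χ' Ψ.1 Ψ.2 * doubleRTk C a ext ρ Ψ.1 Ψ.2)
  simp only at h
  simp_rw [doubleRTk_rescale hs C ha hext ρ] at h
  rw [abs_of_pos (inv_pos.mpr (pow_pos hσ _))] at h
  have hne : (s ^ (((P.d : ℝ) - 2) / 2)) ^ (Fintype.card (PBond P (k + 1)) + N * Fintype.card (Site P (k + 1))) ≠ 0 :=
    (pow_pos hσ _).ne'
  have h' := congrArg
    (fun t => (s ^ (((P.d : ℝ) - 2) / 2)) ^ (Fintype.card (PBond P (k + 1)) + N * Fintype.card (Site P (k + 1))) * t) h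
  simp only [← mul_assoc, mul_inv_cancel₀ hne, one_mul] at h'
  rw [← h', ← integral_const_mul, ← integral_const_mul]
  refine integral_congr_ae (Filter.Eventually.of_forall fun Ψ' => ?_)
  simp only
  ring

end Outer

end Literature.MathematicalPhysics.QuantumFieldTheory.Balaban1983to89.HiggsDoubleRTRescale
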